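import Mathlib
import HarnessLib.Audit
import Summits.PneNP.PneNP.Theorems.ClusOshSplit

/-!
# Route ClusUniversalCertificate — F1(b): the recursion `S(Y) = S(U) + S(I) + |I|` (osh-P2.md §2), closing `ClusOshRungs.OshSucc`
(rung F-N1, cell pnp-ideate, crux `UniversalCertAll` = stmt-PneNP-19683; planner p1 g14; restricted-model combinatorics — nothing here bears on `P` versus `NP`)

By `ClusOshSplit.colexStd_emb` / `colexStd_insert` the colex-standard monomials of `Y ⊆ 𝔽₂^{N+1}` are the `x_S` with `x_S` standard for the projection `U`
and the `x_S x_N` with `x_S` standard for the double fibres `I`; summing degrees and using `#osh(I) = |I|` (`ClusOshBasic.oshCount_top`):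

* `oshS_succ` — `oshS Y = oshS (proj Y) + oshS (dbl Y) + (dbl Y).card`; `oshSucc : OshSucc` (the node of `ClusOshRungs`, by name).
-/

set_option linter.dupNamespace false -- `Summit.PneNP.PneNP.…`: summit = sub-problem name (D-0017 single-conjunct layout)

namespace Summit.PneNP.PneNP.Theorems.ClusHilbert.Osh

open Finset
open Summit.PneNP.PneNP.Theorems.ClusCube (V)

variable {N : ℕ}

/-- The sets of `Fin (N+1)` are the `emb S` and the `emb S ∪ {N}`: re-indexing a sum. -/
theorem sum_split_last (f : Finset (Fin (N + 1)) → ℕ) :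
    ∑ T : Finset (Fin (N + 1)), f T = ∑ S : Finset (Fin N), f (emb S) + ∑ S : Finset (Fin N), f (insert (Fin.last N) (emb S)) := by
  classical
  rw [← sum_filter_add_sum_filter_not univ (fun T : Finset (Fin (N + 1)) => Fin.last N ∉ T)]
  congr 1
  · -- `{T : last ∉ T}` is the image of `emb`
    have himg : (univ.filter fun T : Finset (Fin (N + 1)) => Fin.last N ∉ T) = univ.image emb := by
      ext T
      simp only [mem_filter, mem_univ, true_and, mem_image]
      constructor
      · intro h; exact ⟨cut T, emb_cut h⟩
      · rintro ⟨S, rfl⟩; exact last_notMem_emb S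
    rw [himg, sum_image fun S _ S' _ h => emb_injective h]
  · have himg : (univ.filter fun T : Finset (Fin (N + 1)) => ¬ Fin.last N ∉ T) = univ.image fun S => insert (Fin.last N) (emb S) := by
      ext T
      simp only [mem_filter, mem_univ, true_and, mem_image, not_not]
      constructor
      · intro h
        refine ⟨cut (T.erase (Fin.last N)), ?_⟩
        rw [emb_cut (fun h' => (mem_erase.1 h').1 rfl), insert_erase h]
      · rintro ⟨S, rfl⟩; exact mem_insert_self _ _
    rw [himg, sum_image]
    intro S _ S' _ h
    have := congrArg (fun T => T.erase (Fin.last N)) h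
    simp only [erase_insert (last_notMem_emb _)] at this
    exact emb_injective this

/-- **F1(b): the recursion `S(Y) = S(U) + S(I) + |I|`** along the largest variable. -/
theorem oshS_succ (Y : Finset (V (N + 1))) : oshS Y = oshS (proj Y) + oshS (dbl Y) + (dbl Y).card := by
  classical
  unfold oshS
  rw [sum_split_last]
  have h1 : ∑ S : Finset (Fin N), (if colexStd Y (emb S) then (emb S).card else 0) =
      ∑ S : Finset (Fin N), (if colexStd (proj Y) S then S.card else 0) :=
    sum_congr rfl fun S _ => by rw [card_emb]; simp only [colexStd_emb]
  have h2 : ∑ S : Finset (Fin N), (if colexStd Y (insert (Fin.last N) (emb S)) then (insert (Fin.last N) (emb S)).card else 0) =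
      ∑ S : Finset (Fin N), (if colexStd (dbl Y) S then S.card else 0) + ∑ S : Finset (Fin N), (if colexStd (dbl Y) S then 1 else 0) := by
    rw [← sum_add_distrib]
    refine sum_congr rfl fun S _ => ?_
    rw [card_insert_of_notMem (last_notMem_emb S), card_emb]
    simp only [colexStd_insert]
    split_ifs <;> rfl
  have h3 : ∑ S : Finset (Fin N), (if colexStd (dbl Y) S then 1 else 0) = (dbl Y).card := by
    rw [sum_boole, Nat.cast_id, ← oshCount_top (dbl Y)]
    unfold oshCount
    congr 1
    exact filter_congr fun S _ => ⟨fun h => ⟨h, (card_le_univ S).trans (by rw [Fintype.card_fin])⟩, fun h => h.1⟩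
  rw [h1, h2, h3, add_assoc]

/-- **`OshSucc` holds** (the node of `ClusOshRungs`, by name). -/
theorem oshSucc : OshSucc := fun _ Y => oshS_succ Y

end Summit.PneNP.PneNP.Theorems.ClusHilbert.Osh
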